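import Summits.BirchSwinnertonDyer.BirchSwinnertonDyer.Theorems.ResidualThetaTransportAtTwoThetaLayerLambdaCongruenceAtTwoMuPropagation
import Summits.BirchSwinnertonDyer.BirchSwinnertonDyer.Theorems.ResidualThetaTransportAtTwoResidualThetaMainConjectureAtTwoLayerToolkit
import HarnessLib

/-!
# Crux `ThetaLayerLambdaCongruenceAtTwo` (stmt-BirchSwinnertonDyer-20688), line `birth` v4: the THREE-TERM RELATION of the
# layer elements at `p = 2` for `a₂ = 0` and the `λ`-GROWTH LAW `λ(ϑ_{n+2}) = λ(ϑ_n) + 2ⁿ` from `μ(ϑ_n) = 0`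

Width seat bsd-wall-rtt-p3-w3 (`--supports stmt-BirchSwinnertonDyer-20688`; closes nothing). THEOREMS ONLY, route-independent.

For a newform `g` on `Γ₀(M)`, `2 ∤ M`, `a₂(g) = 0`, a plus period `Ω`, write `b(i, N) = [5ⁱ/2ᴺ]⁺_{g,Ω} ∈ K_g` and
`H_m = ∑_{i<2^m} b(i, m+2) (X+1)^i ∈ K_g[X]` — the single-count ("half") layer-`m` Mazur–Tate element, so that the
tree's `θ_m(g;Ω) = mazurTateElementK g Ω 2 m = C 2 · H_m` (`…Doubling`, `halfLayer_eq_sum_range`).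

## What is proved

* §1 `five_pow_two_pow` (`5^{2^k} = 1 + 2^{k+2}·odd`), periodicity `b(i + 2^m, m+2) = b(i, m+2)`, and the Hecke
  relation at `2` in the form `b(i, m+2) = −(b(i, m+4) + b(i + 2^{m+1}, m+4))` (`…MuPropagation.plusSymbolK_div_two_pow`).
* §2 **THREE-TERM RELATION** (Mazur–Tate / Pollack–Weston Prop. 2.5 with `a_p = 0`, read at `p = 2`, for the tree's
  objects): `H_{m+2} %ₘ ω_{m+1} = −((X+1)^{2^m} + 1)·H_m`, `ω_{m+1} = (X+1)^{2^{m+1}} − 1` — i.e.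
  `π^{m+2}_{m+1} ϑ_{m+2} = −ν^{m}_{m+1} ϑ_m` (`halfLayer_three_term`).
* §3 **`λ`-GROWTH LAW** over `ℚ̄₂` at a COHOMOLOGICAL period: `‖(X+1)^{2^m} + 1‖_sup = 1`, `λ((X+1)^{2^m} + 1) = 2^m`;
  hence if `μ(ϑ_m) = 0` (`‖θ_m(g;Ω)^ι‖_sup = ‖2‖₂`) then `μ(ϑ_{m+2}) = 0` AND
  `λ(θ_{m+2}(g;Ω)^ι) = λ(θ_m(g;Ω)^ι) + 2^m` (`layerLambda_map_mazurTateElementK_two_add_two`), and by induction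
  `3·λ(θ_{m+2k}^ι) + 2^m = 3·λ(θ_m^ι) + 2^m·4^k` (`layerLambda_map_mazurTateElementK_two_add_two_mul`): for `m = 0`
  this is the measured law `λ(θ_{2k}) = λ + (4^k − 1)/3` (KIT-RESULT-TP2-CM-ANCHORS, D-rtt-1), obtained here from the
  Hecke relation at `2` ALONE (no Pollack/Sprung pair, no `L^♯/L^♭`). Consequence for stub (μ♮) of skeleton v4: the
  `λ`-room `λ(ϑ_n) + Σ_v λ(E_v) < 2ⁿ` needed at the depleted level holds for all large even `n` as soon as `μ(ϑ_{n₁}) = 0`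
  at one even layer (`λ(ϑ_n) ≤ λ(ϑ_{n₁}) + 2ⁿ/3`).

Nothing about any curve or form is asserted; BSD is not proved by any of this.

References: [MazurTateTeitelbaum1986Invent] §I.4 (4.2), §I.13; [PollackWeston2011MT] Prop. 2.5, §3.1, §4 (Thm. 4.1:
`λ(θ_n) = q_n + λ^±`, printed for odd `p`); [Kurihara2002] §1 (three-term relation for `a_p = 0`).
-/

noncomputable section

-- justification: the `Summit.BirchSwinnertonDyer.BirchSwinnertonDyer.…` path repeats a component (route-file convention)
set_option linter.dupNamespace false

open scoped Classical

open Polynomial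

open Literature.NumberTheory.IwasawaTheory Literature.NumberTheory.EllipticCurves
  Literature.NumberTheory.EllipticCurves.ModularForms

namespace Summit.BirchSwinnertonDyer.BirchSwinnertonDyer.Theorems.ThetaLayerLambdaCongruenceAtTwo

/-! ## §1. `5^{2^k} = 1 + 2^{k+2}·odd`; the symbols `b(i, N) = [5ⁱ/2ᴺ]⁺` -/

/-- `5^{2^k} = 1 + 2^{k+2}·u` with `u` odd (`v₂(5^{2^k} − 1) = k + 2`; induction, `(1 + 2^{k+2}u)² = 1 + 2^{k+3}(u + 2^{k+1}u²)`).
[cite: Serre1973, Ch. II §3.2 (structure of 1 + 4ℤ₂)] -/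
theorem five_pow_two_pow (k : ℕ) : ∃ u : ℕ, Odd u ∧ 5 ^ (2 ^ k) = 1 + 2 ^ (k + 2) * u := by
  induction k with
  | zero => exact ⟨1, odd_one, by norm_num⟩
  | succ k ih =>
    obtain ⟨u, hu, h⟩ := ih
    refine ⟨u + 2 ^ (k + 1) * u ^ 2, ?_, ?_⟩
    · refine hu.add_even (Even.mul_right ?_ _)
      exact (Nat.even_pow' (by omega)).mpr even_two
    · rw [pow_succ, pow_mul, h]
      ring

section Symbols

variable {M : ℕ} [NeZero M] {g : CuspForm (CongruenceSubgroup.Gamma0 M) 2} (Ω : ℂ)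

/-- The layer symbol at the residue `5ⁱ mod 2ᴺ` is the symbol at `5ⁱ/2ᴺ` (periodicity `[r + k]⁺ = [r]⁺`).
[cite: Manin1972, §1.2] -/
theorem plusSymbolK_val_pow_div (N i : ℕ) :
    plusSymbolK g Ω (((((cyclotomicGenerator 2 : ZMod (2 ^ N)) ^ i).val : ℕ) : ℚ) / (2 : ℚ) ^ N) =
      plusSymbolK g Ω ((5 : ℚ) ^ i / (2 : ℚ) ^ N) := by
  rw [cyclotomicGenerator_two, Nat.cast_ofNat, show ((5 : ZMod (2 ^ N)) ^ i) = ((5 ^ i : ℕ) : ZMod (2 ^ N)) by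
    push_cast; rfl, ZMod.val_natCast]
  obtain ⟨q, r, hqr, hr⟩ : ∃ q r : ℕ, r + 2 ^ N * q = 5 ^ i ∧ 5 ^ i % 2 ^ N = r :=
    ⟨5 ^ i / 2 ^ N, 5 ^ i % 2 ^ N, Nat.mod_add_div _ _, rfl⟩
  rw [hr]
  have hqr' : (r : ℚ) + (2 : ℚ) ^ N * (q : ℚ) = (5 : ℚ) ^ i := by exact_mod_cast hqr
  have e : (5 : ℚ) ^ i / (2 : ℚ) ^ N = (r : ℚ) / (2 : ℚ) ^ N + ((q : ℤ) : ℚ) := by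
    have h2 : ((2 : ℚ) ^ N) ≠ 0 := by positivity
    rw [← hqr']
    push_cast
    field_simp
  rw [e, plusSymbolK_add_intCast]

/-- Periodicity in the exponent: `[5^{2^m + i}/2^{m+2}]⁺ = [5ⁱ/2^{m+2}]⁺` (`5^{2^m} ≡ 1 mod 2^{m+2}`).
[cite: Serre1973, Ch. II §3.2] -/
theorem plusSymbolK_pow_add_two_pow_div (m i : ℕ) :
    plusSymbolK g Ω ((5 : ℚ) ^ (2 ^ m + i) / (2 : ℚ) ^ (m + 2)) = plusSymbolK g Ω ((5 : ℚ) ^ i / (2 : ℚ) ^ (m + 2)) := by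
  obtain ⟨u, -, hu⟩ := five_pow_two_pow m
  have e : (5 : ℚ) ^ (2 ^ m + i) / (2 : ℚ) ^ (m + 2) = (5 : ℚ) ^ i / (2 : ℚ) ^ (m + 2) + (((5 ^ i * u : ℕ) : ℤ) : ℚ) := by
    have h2 : ((2 : ℚ) ^ (m + 2)) ≠ 0 := by positivity
    have hu' : ((5 : ℚ) ^ (2 ^ m)) = 1 + (2 : ℚ) ^ (m + 2) * (u : ℚ) := by exact_mod_cast hu
    rw [pow_add, hu']
    push_cast
    field_simp
  rw [e, plusSymbolK_add_intCast]

/-- **Hecke at `2` for the symbols `b(i, N) = [5ⁱ/2ᴺ]⁺`** (`a₂(g) = 0`, `2 ∤ M`):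
`b(i, m+2) = −(b(i, m+4) + b(i + 2^{m+1}, m+4))` — `plusSymbolK_div_two_pow` with `x = 5ⁱ`, and
`(5ⁱ + 2^{m+3})/2^{m+4} ≡ 5^{2^{m+1}+i}/2^{m+4} (mod ℤ)` because `5^{2^{m+1}} = 1 + 2^{m+3}·odd`.
[cite: MazurTateTeitelbaum1986Invent, §I.4 (4.2)] -/
theorem plusSymbolK_pow_div_hecke (hg : IsNewform0 g) (h2M : ¬ 2 ∣ M) (ha2 : cuspCoeff g 2 = 0)
    (hΩ : IsPlusPeriod g Ω) (m i : ℕ) :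
    plusSymbolK g Ω ((5 : ℚ) ^ i / (2 : ℚ) ^ (m + 2)) =
      -(plusSymbolK g Ω ((5 : ℚ) ^ i / (2 : ℚ) ^ (m + 4)) +
        plusSymbolK g Ω ((5 : ℚ) ^ (2 ^ (m + 1) + i) / (2 : ℚ) ^ (m + 4))) := by
  rw [plusSymbolK_div_two_pow Ω hg h2M ha2 hΩ ((5 : ℚ) ^ i) (m + 2)]
  congr 2
  -- `(5ⁱ + 2^{m+3})/2^{m+4}` and `5^{2^{m+1}+i}/2^{m+4}` differ by an integer
  obtain ⟨u, hu, h5⟩ := five_pow_two_pow (m + 1)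
  obtain ⟨w, hw⟩ := (Odd.pow (by decide : Odd 5) (n := i)).mul hu
  -- 5^i * u = 2 w + 1
  have e : (5 : ℚ) ^ (2 ^ (m + 1) + i) / (2 : ℚ) ^ (m + 4) =
      ((5 : ℚ) ^ i + (2 : ℚ) ^ (m + 2 + 1)) / (2 : ℚ) ^ (m + 2 + 2) + ((w : ℤ) : ℚ) := by
    have h2 : ((2 : ℚ) ^ (m + 4)) ≠ 0 := by positivity
    have h5' : ((5 : ℚ) ^ (2 ^ (m + 1))) = 1 + (2 : ℚ) ^ (m + 1 + 2) * (u : ℚ) := by exact_mod_cast h5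
    have hw' : ((5 : ℚ) ^ i) * (u : ℚ) = 2 * (w : ℚ) + 1 := by exact_mod_cast hw
    rw [pow_add, h5', show m + 2 + 1 = m + 3 by ring, show m + 2 + 2 = m + 4 by ring,
      show m + 1 + 2 = m + 3 by ring]
    push_cast
    field_simp
    linear_combination (8 * 2 ^ m) * hw'
  rw [e, plusSymbolK_add_intCast]

/-- The tree-indexed half element equals the range-indexed sum of the `b(i, m+2)`:
`∑_{s : ZMod 2^m} C[5^{s}/2^{m+2} mod]⁺ (X+1)^{s} = ∑_{i<2^m} C b(i, m+2) (X+1)^i`. [cite: PollackWeston2011MT, §2.1 (2.1)] -/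
theorem halfLayer_eq_sum_range (m : ℕ) :
    (∑ s : ZMod (2 ^ m), C (plusSymbolK g Ω
        (((((cyclotomicGenerator 2 : ZMod (2 ^ (m + 2))) ^ s.val).val : ℕ) : ℚ) / (2 : ℚ) ^ (m + 2))) *
          (X + 1) ^ s.val) =
      ∑ i ∈ Finset.range (2 ^ m), C (plusSymbolK g Ω ((5 : ℚ) ^ i / (2 : ℚ) ^ (m + 2))) * (X + 1) ^ i := by
  haveI : NeZero (2 ^ m) := ⟨pow_ne_zero _ two_ne_zero⟩
  simp_rw [plusSymbolK_val_pow_div]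
  refine Finset.sum_nbij (fun s : ZMod (2 ^ m) ↦ s.val) (fun s _ ↦ Finset.mem_range.mpr (ZMod.val_lt s))
    (fun s _ t _ h ↦ ZMod.val_injective _ h) (fun i hi ↦ ?_) (fun s _ ↦ rfl)
  refine ⟨(i : ZMod (2 ^ m)), Finset.mem_coe.mpr (Finset.mem_univ _), ?_⟩
  exact ZMod.val_natCast_of_lt (Finset.mem_range.mp (Finset.mem_coe.mp hi))

end Symbols

/-! ## §2. The three-term relation `π ϑ_{m+2} = −ν ϑ_m` -/

section ThreeTerm

/-- `(X+1)^{2^k} − 1` over a field is monic of degree `2^k` (private helper). [folklore] -/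
private theorem monic_and_natDegree_X_add_one_pow_two_pow_sub_one (K : Type*) [Field K] (k : ℕ) :
    ((X + 1 : K[X]) ^ 2 ^ k - 1).Monic ∧ ((X + 1 : K[X]) ^ 2 ^ k - 1).natDegree = 2 ^ k := by
  have e : (X + 1 : K[X]) = X + C 1 := by rw [C_1]
  have hdeg : ((X + 1 : K[X]) ^ 2 ^ k).natDegree = 2 ^ k := by
    rw [e, natDegree_pow, natDegree_X_add_C, mul_one]
  have hlt : (1 : K[X]).natDegree < ((X + 1 : K[X]) ^ 2 ^ k).natDegree := by
    rw [hdeg, natDegree_one]; exact pow_pos two_pos _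
  refine ⟨?_, ?_⟩
  · exact Monic.sub_of_left (by rw [e]; exact (monic_X_add_C 1).pow _) (degree_lt_degree hlt)
  · rw [natDegree_sub_eq_left_of_natDegree_lt hlt, hdeg]

variable {M : ℕ} [NeZero M] {g : CuspForm (CongruenceSubgroup.Gamma0 M) 2} (Ω : ℂ)

/-- **THREE-TERM RELATION at `p = 2`, `a₂ = 0`** (Mazur–Tate; Pollack–Weston Prop. 2.5 `π θ_{n+1} = a_p θ_n − ν θ_{n−1}`
with `a_p = 0`, read at `2` for the single-count layer elements `H_m = ∑_{i<2^m} [5ⁱ/2^{m+2}]⁺ (X+1)^i` of a newform `g`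
on `Γ₀(M)`, `2 ∤ M`, `a₂(g) = 0`, at a plus period `Ω`):
`H_{m+2} %ₘ ((X+1)^{2^{m+1}} − 1) = −((X+1)^{2^m} + 1)·H_m`.
PROOF: modulo `ω_{m+1}`, `(X+1)^{2^{m+1}+i} ≡ (X+1)^i`, so `H_{m+2} ≡ ∑_{i<2^{m+1}} (b(i,m+4) + b(2^{m+1}+i,m+4))(X+1)^i
= −∑_{i<2^{m+1}} b(i,m+2)(X+1)^i` (Hecke at `2`) `= −((X+1)^{2^m}+1)·H_m` (periodicity `b(2^m+i,m+2) = b(i,m+2)`), a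
polynomial of degree `< 2^{m+1}`. [cite: PollackWeston2011MT, Prop. 2.5 (three-term relation; a_p = 0, read at p = 2)] -/
theorem halfLayer_three_term (hg : IsNewform0 g) (h2M : ¬ 2 ∣ M) (ha2 : cuspCoeff g 2 = 0) (hΩ : IsPlusPeriod g Ω)
    (m : ℕ) :
    (∑ i ∈ Finset.range (2 ^ (m + 2)), C (plusSymbolK g Ω ((5 : ℚ) ^ i / (2 : ℚ) ^ (m + 2 + 2))) * (X + 1) ^ i) %ₘ
        ((X + 1) ^ 2 ^ (m + 1) - 1) =
      -(((X + 1) ^ 2 ^ m + 1) *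
        ∑ i ∈ Finset.range (2 ^ m), C (plusSymbolK g Ω ((5 : ℚ) ^ i / (2 : ℚ) ^ (m + 2))) * (X + 1) ^ i) := by
  -- abbreviations
  set b : ℕ → ℕ → coeffField g := fun i N ↦ plusSymbolK g Ω ((5 : ℚ) ^ i / (2 : ℚ) ^ N) with hb
  set ω : (coeffField g)[X] := (X + 1) ^ 2 ^ (m + 1) - 1 with hω
  obtain ⟨hωm, hωdeg⟩ := monic_and_natDegree_X_add_one_pow_two_pow_sub_one (coeffField g) (m + 1)
  -- Step 1: split the range `2^{m+2} = 2^{m+1} + 2^{m+1}` and reduce `(X+1)^{2^{m+1}+i}` modulo `ω`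
  set G : (coeffField g)[X] :=
    ∑ i ∈ Finset.range (2 ^ (m + 1)), C (b i (m + 4) + b (2 ^ (m + 1) + i) (m + 4)) * (X + 1) ^ i with hG
  have hsplit : (∑ i ∈ Finset.range (2 ^ (m + 2)), C (b i (m + 2 + 2)) * (X + 1) ^ i) =
      G + ω * ∑ i ∈ Finset.range (2 ^ (m + 1)), C (b (2 ^ (m + 1) + i) (m + 4)) * (X + 1) ^ i := by
    rw [show 2 ^ (m + 2) = 2 ^ (m + 1) + 2 ^ (m + 1) by ring, Finset.sum_range_add, hG, Finset.mul_sum,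
      ← Finset.sum_add_distrib, ← Finset.sum_add_distrib]
    refine Finset.sum_congr rfl fun i _ ↦ ?_
    rw [show m + 2 + 2 = m + 4 by ring, map_add, hω, pow_add]
    ring
  have hmod : (∑ i ∈ Finset.range (2 ^ (m + 2)), C (b i (m + 2 + 2)) * (X + 1) ^ i) %ₘ ω = G %ₘ ω := by
    apply modByMonic_eq_of_dvd_sub hωm
    rw [hsplit, add_sub_cancel_left]
    exact dvd_mul_right _ _
  -- Step 2: Hecke at `2` and periodicity: `G = −((X+1)^{2^m}+1)·H_m`
  have hGeq : G = -(((X + 1) ^ 2 ^ m + 1) * ∑ i ∈ Finset.range (2 ^ m), C (b i (m + 2)) * (X + 1) ^ i) := by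
    have h1 : G = -∑ i ∈ Finset.range (2 ^ (m + 1)), C (b i (m + 2)) * (X + 1) ^ i := by
      rw [hG, ← Finset.sum_neg_distrib]
      refine Finset.sum_congr rfl fun i _ ↦ ?_
      rw [hb]
      dsimp only
      rw [plusSymbolK_pow_div_hecke Ω hg h2M ha2 hΩ m i, map_neg, neg_mul, neg_neg]
    rw [h1, show 2 ^ (m + 1) = 2 ^ m + 2 ^ m by ring, Finset.sum_range_add, Finset.mul_sum, ← Finset.sum_add_distrib]
    congr 1
    refine Finset.sum_congr rfl fun i _ ↦ ?_
    rw [hb]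
    dsimp only
    rw [plusSymbolK_pow_add_two_pow_div, pow_add]
    ring
  -- Step 3: the right-hand side has degree `< 2^{m+1} = deg ω`, so it is its own remainder
  have hXe : (X + 1 : (coeffField g)[X]) = X + C 1 := by rw [C_1]
  have hPdeg : ((X + 1) ^ 2 ^ m + 1 : (coeffField g)[X]).natDegree ≤ 2 ^ m := by
    refine (natDegree_add_le _ _).trans (max_le ?_ (by rw [natDegree_one]; exact Nat.zero_le _))
    rw [hXe, natDegree_pow, natDegree_X_add_C, mul_one]
  have hSdeg : (∑ i ∈ Finset.range (2 ^ m), C (b i (m + 2)) * (X + 1) ^ i).natDegree ≤ 2 ^ m - 1 := by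
    refine natDegree_sum_le_of_forall_le _ _ fun i hi ↦ ?_
    refine (natDegree_C_mul_le _ _).trans ((natDegree_pow_le).trans ?_)
    have hi' := Finset.mem_range.mp hi
    have h1 : (X + 1 : (coeffField g)[X]).natDegree ≤ 1 :=
      (natDegree_add_le _ _).trans (max_le natDegree_X_le (by rw [natDegree_one]; exact Nat.zero_le _))
    calc i * (X + 1 : (coeffField g)[X]).natDegree ≤ i * 1 := Nat.mul_le_mul_left i h1
      _ ≤ 2 ^ m - 1 := by omega
  have hdeg : (-(((X + 1) ^ 2 ^ m + 1) *
      ∑ i ∈ Finset.range (2 ^ m), C (b i (m + 2)) * (X + 1) ^ i)).degree < ω.degree := by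
    apply degree_lt_degree
    rw [natDegree_neg, hωdeg]
    refine (natDegree_mul_le).trans_lt ?_
    have h2m : 1 ≤ 2 ^ m := Nat.one_le_two_pow
    calc ((X + 1) ^ 2 ^ m + 1 : (coeffField g)[X]).natDegree +
          (∑ i ∈ Finset.range (2 ^ m), C (b i (m + 2)) * (X + 1) ^ i).natDegree
        ≤ 2 ^ m + (2 ^ m - 1) := Nat.add_le_add hPdeg hSdeg
      _ < 2 ^ (m + 1) := by rw [pow_succ]; omega
  rw [hmod, hGeq]
  exact (modByMonic_eq_self_iff hωm).mpr hdeg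

end ThreeTerm

/-! ## §3. The `λ`-growth law at a cohomological period -/

section Growth

/-- Over `ℚ̄₂`: `‖(X+1)^{2^m} + 1‖_sup = 1` and `λ((X+1)^{2^m} + 1) = 2^m` — the coefficients are `2` (index `0`), the even
binomials `C(2^m, j)` (`0 < j < 2^m`), and `1` (index `2^m`). This is the relative norm element `ν = 1 + γ^{2^m}` of the
layer extension `ℚ_{m+1}/ℚ_m`, `λ(ν) = [ℚ_{m+1} : ℚ] − [ℚ_m : ℚ] = 2^m`. [cite: PollackWeston2011MT, §4 (corestriction, shape)] -/
theorem supNorm_and_layerLambda_X_add_one_pow_two_pow_add_one (m : ℕ) :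
    ((X + 1) ^ 2 ^ m + 1 : (PadicAlgCl 2)[X]).supNorm = 1 ∧
      layerLambda ((X + 1) ^ 2 ^ m + 1 : (PadicAlgCl 2)[X]) = 2 ^ m := by
  set P : (PadicAlgCl 2)[X] := (X + 1) ^ 2 ^ m + 1 with hP
  have hcoeff : ∀ j, P.coeff j = ((2 ^ m).choose j : PadicAlgCl 2) + if j = 0 then 1 else 0 := by
    intro j
    rw [hP, coeff_add, coeff_X_add_one_pow, coeff_one]
  have htop : P.coeff (2 ^ m) = 1 := by
    rw [hcoeff, Nat.choose_self, if_neg (pow_ne_zero _ two_ne_zero), Nat.cast_one, add_zero]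
  have hlow : ∀ j < 2 ^ m, ‖P.coeff j‖ < 1 := by
    intro j hj
    rw [hcoeff]
    by_cases hj0 : j = 0
    · subst hj0
      rw [if_pos rfl, Nat.choose_zero_right, Nat.cast_one, show (1 : PadicAlgCl 2) + 1 = ((2 : ℕ) : PadicAlgCl 2) by
        norm_num]
      exact (norm_natCast_padicAlgCl_le_inv_of_dvd (p := 2) (dvd_refl 2)).trans_lt (by norm_num)
    · rw [if_neg hj0, add_zero]
      exact (norm_natCast_padicAlgCl_le_inv_of_dvd (p := 2)
        (Nat.Prime.dvd_choose_pow Nat.prime_two hj0 hj.ne)).trans_lt (by norm_num)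
  have hhigh : ∀ j, 2 ^ m < j → P.coeff j = 0 := by
    intro j hj
    have hj0 : j ≠ 0 := Nat.pos_iff_ne_zero.mp (lt_of_le_of_lt (Nat.zero_le _) hj)
    rw [hcoeff, Nat.choose_eq_zero_of_lt hj, if_neg hj0, Nat.cast_zero, add_zero]
  have hle : ∀ j, ‖P.coeff j‖ ≤ 1 := by
    intro j
    rcases lt_trichotomy j (2 ^ m) with h | h | h
    · exact (hlow j h).le
    · rw [h, htop, norm_one]
    · rw [hhigh j h, norm_zero]; exact zero_le_one
  have hsup : P.supNorm = 1 := by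
    refine le_antisymm (supNorm_le_of_forall_coeff_le hle) ?_
    rw [← norm_one (α := PadicAlgCl 2), ← htop]
    exact P.le_supNorm _
  refine ⟨hsup, layerLambda_eq_iff.mpr ⟨?_, fun j hj ↦ ?_⟩⟩
  · rw [hsup, htop, norm_one]
  · rw [hsup]; exact hlow j hj

variable {M : ℕ} [NeZero M] {g : CuspForm (CongruenceSubgroup.Gamma0 M) 2}
  {ι : coeffField g →+* PadicAlgCl 2} {Ω : ℂ}

/-- The tree's layer element through `ι` is `C 2` times the image of the range-indexed half element:
`θ_k(g;Ω)^ι = C 2 · (∑_{i<2^k} C b(i,k+2) (X+1)^i)^ι`. [cite: MazurTateTeitelbaum1986Invent, §I.13] -/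
theorem map_mazurTateElementK_two_eq_C_two_mul_map_sum_range (ι : coeffField g →+* PadicAlgCl 2) (Ω : ℂ) (k : ℕ) :
    (mazurTateElementK g Ω 2 k).map ι = C (2 : PadicAlgCl 2) *
      (∑ i ∈ Finset.range (2 ^ k), C (plusSymbolK g Ω ((5 : ℚ) ^ i / (2 : ℚ) ^ (k + 2))) * (X + 1) ^ i).map ι := by
  rw [mazurTateElementK_two, halfLayer_eq_sum_range, Polynomial.map_mul, Polynomial.map_C, map_ofNat]

/-- **THE `λ`-GROWTH LAW at `p = 2` for `a₂ = 0`** (Kurihara / Perrin-Riou / Pollack–Weston `λ(θ_n) = q_n + λ`, read at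
`2`, from the three-term relation ALONE): for a newform `g` on `Γ₀(M)`, `2 ∤ M`, `a₂(g) = 0`, a COHOMOLOGICAL plus period
`Ω` along `ι`, and a layer `m` with `μ(ϑ_m) = 0` (`‖θ_m(g;Ω)^ι‖_sup = ‖2‖₂`): `μ(ϑ_{m+2}) = 0` and
`λ(θ_{m+2}(g;Ω)^ι) = λ(θ_m(g;Ω)^ι) + 2^m`. PROOF: `ϑ_{m+2} %ₘ ω_{m+1} = −((X+1)^{2^m}+1)·ϑ_m` (three-term relation) has
sup norm `1·1 = 1 ≤ ‖ϑ_{m+2}‖ ≤ 1`, so the reduction preserves the sup norm, whence `λ(ϑ_{m+2}) < 2^{m+1}` (reduction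
survival, `…MuDictionary`) and `λ(ϑ_{m+2}) = λ(ϑ_{m+2} %ₘ ω_{m+1}) = λ((X+1)^{2^m}+1) + λ(ϑ_m) = 2^m + λ(ϑ_m)`.
[cite: PollackWeston2011MT, Thm. 4.1 and §4 (λ(θ_n) = q_n + λ^± for a_p = 0; printed for odd p)] -/
theorem layerLambda_map_mazurTateElementK_two_add_two (hg : IsNewform0 g) (h2M : ¬ 2 ∣ M)
    (ha2 : cuspCoeff g 2 = 0) (h : IsCohomologicalPlusPeriod g ι Ω) {m : ℕ}
    (hμ : ((mazurTateElementK g Ω 2 m).map ι).supNorm = ‖(2 : PadicAlgCl 2)‖) :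
    ((mazurTateElementK g Ω 2 (m + 2)).map ι).supNorm = ‖(2 : PadicAlgCl 2)‖ ∧
      layerLambda ((mazurTateElementK g Ω 2 (m + 2)).map ι) =
        layerLambda ((mazurTateElementK g Ω 2 m).map ι) + 2 ^ m := by
  -- the half elements through `ι`
  set A : (PadicAlgCl 2)[X] :=
    (∑ i ∈ Finset.range (2 ^ m), C (plusSymbolK g Ω ((5 : ℚ) ^ i / (2 : ℚ) ^ (m + 2))) * (X + 1) ^ i).map ι with hA
  set B : (PadicAlgCl 2)[X] :=
    (∑ i ∈ Finset.range (2 ^ (m + 2)), C (plusSymbolK g Ω ((5 : ℚ) ^ i / (2 : ℚ) ^ (m + 2 + 2))) *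
      (X + 1) ^ i).map ι with hB
  obtain ⟨hPn, hPl⟩ := supNorm_and_layerLambda_X_add_one_pow_two_pow_add_one m
  set P : (PadicAlgCl 2)[X] := (X + 1) ^ 2 ^ m + 1 with hP
  have h2 : (0 : ℝ) < ‖(2 : PadicAlgCl 2)‖ := norm_pos_iff.mpr two_ne_zero
  have hθm : (mazurTateElementK g Ω 2 m).map ι = C (2 : PadicAlgCl 2) * A :=
    map_mazurTateElementK_two_eq_C_two_mul_map_sum_range ι Ω m
  have hθm2 : (mazurTateElementK g Ω 2 (m + 2)).map ι = C (2 : PadicAlgCl 2) * B :=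
    map_mazurTateElementK_two_eq_C_two_mul_map_sum_range ι Ω (m + 2)
  -- `‖A‖ = 1`, `‖B‖ ≤ 1`
  have hAn : A.supNorm = 1 := by
    rw [hθm, supNorm_C_mul] at hμ
    exact mul_left_cancel₀ h2.ne' (hμ.trans (mul_one _).symm)
  have hBle : B.supNorm ≤ 1 := by
    have hle := supNorm_map_mazurTateElementK_two_le h (m + 2)
    rw [hθm2, supNorm_C_mul] at hle
    exact le_of_mul_le_mul_left (hle.trans (mul_one _).symm.le) h2
  -- the three-term relation through `ι`
  obtain ⟨hωm, -⟩ := monic_and_natDegree_X_add_one_pow_two_pow_sub_one (coeffField g) (m + 1)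
  have h3 : B %ₘ ((X + 1) ^ 2 ^ (m + 1) - 1) = -(P * A) := by
    have h0 := congr_arg (Polynomial.map ι) (halfLayer_three_term Ω hg h2M ha2 h.isPlusPeriod m)
    simp only [Polynomial.map_modByMonic ι hωm, Polynomial.map_sub, Polynomial.map_pow, Polynomial.map_add,
      Polynomial.map_X, Polynomial.map_one, Polynomial.map_neg, Polynomial.map_mul] at h0
    rw [hB, hP, hA]
    exact h0
  have hRn : (-(P * A)).supNorm = 1 := by
    rw [show -(P * A) = C (-1 : PadicAlgCl 2) * (P * A) by simp, supNorm_C_mul, norm_neg, norm_one, one_mul,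
      supNorm_mul', hPn, hAn, mul_one]
  -- survival: `‖B %ₘ ω‖ = 1 ≤ ‖B‖ ≤ 1`
  have hBn : B.supNorm = 1 := by
    refine le_antisymm hBle ?_
    rw [← hRn, ← h3]
    exact supNorm_modByMonic_le (monic_layerModulus (p := 2) (m + 1)) (supNorm_layerModulus_le_one (p := 2) (m + 1)) B
  have hB0 : B ≠ 0 := fun h0 ↦ by rw [h0, supNorm_zero] at hBn; exact zero_ne_one hBn
  have hA0 : A ≠ 0 := fun h0 ↦ by rw [h0, supNorm_zero] at hAn; exact zero_ne_one hAn
  have hP0 : P ≠ 0 := fun h0 ↦ by rw [h0, supNorm_zero] at hPn; exact zero_ne_one hPn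
  have hsurv : (B %ₘ ((X + 1) ^ 2 ^ (m + 1) - 1)).supNorm = B.supNorm := by rw [h3, hRn, hBn]
  have hlamB : layerLambda B < 2 ^ (m + 1) := (supNorm_modByMonic_layerModulus_eq_iff (p := 2) (m + 1) hB0).mp hsurv
  have hlam : layerLambda B = layerLambda A + 2 ^ m := by
    rw [← (layerLambda_modByMonic_layerModulus (p := 2) (m + 1) hB0 hlamB).2, h3,
      show -(P * A) = C (-1 : PadicAlgCl 2) * (P * A) by simp, ResidualThetaLayer.layerLambda_C_mul (neg_ne_zero.mpr one_ne_zero),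
      layerLambda_mul hP0 hA0, hPl, add_comm]
  refine ⟨?_, ?_⟩
  · rw [hθm2, supNorm_C_mul, hBn, mul_one]
  · rw [hθm2, hθm, ResidualThetaLayer.layerLambda_C_mul two_ne_zero, ResidualThetaLayer.layerLambda_C_mul two_ne_zero, hlam]

/-- **Closed form of the `λ`-growth law**: under the same hypotheses, for every `k`,
`μ(ϑ_{m+2k}) = 0` and `3·λ(θ_{m+2k}(g;Ω)^ι) + 2^m = 3·λ(θ_m(g;Ω)^ι) + 2^m·4^k` — i.e.
`λ(θ_{m+2k}) = λ(θ_m) + 2^m(4^k − 1)/3`; for `m = 0`: `λ(θ_{2k}) = λ(θ_0) + (4^k − 1)/3`, the law measured on the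
RTT/TP2 anchors (`λ(θ_n) = λ + (2ⁿ − 1)/3` at even `n`). [cite: PollackWeston2011MT, Thm. 4.1 (λ(θ_n) = q_n + λ; read at p = 2)] -/
theorem layerLambda_map_mazurTateElementK_two_add_two_mul (hg : IsNewform0 g) (h2M : ¬ 2 ∣ M)
    (ha2 : cuspCoeff g 2 = 0) (h : IsCohomologicalPlusPeriod g ι Ω) {m : ℕ}
    (hμ : ((mazurTateElementK g Ω 2 m).map ι).supNorm = ‖(2 : PadicAlgCl 2)‖) (k : ℕ) :
    ((mazurTateElementK g Ω 2 (m + 2 * k)).map ι).supNorm = ‖(2 : PadicAlgCl 2)‖ ∧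
      3 * layerLambda ((mazurTateElementK g Ω 2 (m + 2 * k)).map ι) + 2 ^ m =
        3 * layerLambda ((mazurTateElementK g Ω 2 m).map ι) + 2 ^ m * 4 ^ k := by
  induction k with
  | zero => exact ⟨by simpa using hμ, by simp⟩
  | succ k ih =>
    obtain ⟨hμk, hlk⟩ := ih
    obtain ⟨hμ', hl'⟩ := layerLambda_map_mazurTateElementK_two_add_two hg h2M ha2 h hμk
    have e : m + 2 * (k + 1) = m + 2 * k + 2 := by ring
    rw [e]
    refine ⟨hμ', ?_⟩
    rw [hl']
    have e2 : 2 ^ (m + 2 * k) = 2 ^ m * 4 ^ k := by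
      rw [pow_add, pow_mul]; norm_num
    rw [mul_add, e2, pow_succ]
    linear_combination hlk

end Growth

end Summit.BirchSwinnertonDyer.BirchSwinnertonDyer.Theorems.ThetaLayerLambdaCongruenceAtTwo

end
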